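import Literature.Topology.Immersions.TriplePointsGenericity
import HarnessLib

/-!
# General position of maps into Euclidean space, IV: no quadruple points when `4 dim M < 3 q`

Topic `Literature/Topology/Immersions`. The last clause of general position for maps
`M → ℝ^q` in the range `4n < 3q` (e.g. `4`-manifolds in `ℝ⁶`: `16 < 18`): for almost every
parameter `s` the perturbed map `f_s = f + (T s) ∘ ρ` has **no quadruple points** — no pairwise
distinct `a, b, c, d` with `f_s a = f_s b = f_s c = f_s d` (Hirsch, *Differential Topology*
(1976), Ch. 3 §2 Ex. 2 with `k = 4`: in general position the `k`-fold points form a set of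
dimension `kn - (k-1)q < 0`; Golubitsky–Guillemin (1973), Ch. III §3). By the parametric
transversality theorem (`Literature.Topology.Immersions.volume_setOf_not_surjective_mfderiv_slice_eq_zero`)
applied to `((a,b,c,d), s) ↦ (f_s a - f_s b, f_s b - f_s c, f_s c - f_s d) ∈ ℝ^{3q}` on the
quadruple product minus the fat diagonal — submersive in `s` when `ρ` sends distinct quadruples
to affinely independent ones (`ρ = veronese ∘ ρ₀`, `VeroneseGenericity.lean`) and `T` is rich
(`surjective_apply_triple_of_surjective`) — for a.e. `s` the value `0` is regular for the slice,
which by the dimension count `4n < 3q` means it is not attained: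

* `volume_setOf_exists_quadruplePoint_eq_zero`, `dense_setOf_forall_not_quadruplePoint`.

Everything here is proved; no named facts are introduced.

## References

* M. W. Hirsch, *Differential Topology*, GTM 33 (1976), Ch. 3 §2, Thm. 2.7 and Exercise 2.
  [HirschDT1976]
* M. Golubitsky, V. Guillemin, *Stable Mappings and Their Singularities*, GTM 14 (1973),
  Ch. III §3.
-/

open scoped Manifold ContDiff Topology
open Set Function Module MeasureTheory

noncomputable section

universe u

namespace Literature.Topology.Immersions

/-- Local notation: `𝔼 n` is the model Euclidean space `EuclideanSpace ℝ (Fin n)`. -/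
local notation "𝔼 " n:arg => EuclideanSpace ℝ (Fin n)

open Literature.Geometry.Manifold (dense_compl_of_volume_eq_zero)

variable {n q k b : ℕ} {M : Type u} [TopologicalSpace M] [ChartedSpace (𝔼 n) M]

/-- With `T : ℝᵇ →L (ℝᵏ →L ℝ^q)` onto, `s ↦ (T s u, T s v, T s w)` is onto for independent
`u, v, w`. [folklore] -/
theorem surjective_apply_triple_of_surjective {T : 𝔼 b →L[ℝ] (𝔼 k →L[ℝ] 𝔼 q)}
    (hT : Surjective T) {u v w : 𝔼 k} (huvw : LinearIndependent ℝ ![u, v, w]) :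
    Surjective fun s : 𝔼 b => (T s u, T s v, T s w) := by
  rintro ⟨w₁, w₂, w₃⟩
  obtain ⟨Λ, hΛ⟩ := exists_clm_apply_eq_of_linearIndependent huvw ![w₁, w₂, w₃]
  obtain ⟨s, rfl⟩ := hT Λ
  refine ⟨s, Prod.ext (by simpa using hΛ 0) (Prod.ext (by simpa using hΛ 1) ?_)⟩
  have := hΛ 2
  simpa using this

section Family

variable [T2Space M] [SecondCountableTopology M] [IsManifold (𝓡 n) ∞ M]
  {f : M → 𝔼 q} {ρ : M → 𝔼 k} {T : 𝔼 b →L[ℝ] (𝔼 k →L[ℝ] 𝔼 q)}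

omit [T2Space M] [SecondCountableTopology M] [IsManifold (𝓡 n) ∞ M] in
/-- Dimension count for re-charting the quadruple product. [folklore] -/
theorem finrank_prod4_self_eq :
    finrank ℝ (𝔼 n × (𝔼 n × (𝔼 n × 𝔼 n))) = finrank ℝ (𝔼 (n + (n + (n + n)))) := by
  simp [Module.finrank_prod]

omit [T2Space M] [SecondCountableTopology M] [IsManifold (𝓡 n) ∞ M] in
/-- Dimension count `dim (ℝ^q)³ = dim ℝ^{q+(q+q)}`: duplicate of `finrank_prod_prod_self_eq`
(`TriplePointsGenericity.lean`, with `n := q`), kept as a deprecated alias (dedup-02456). [folklore] -/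
@[deprecated finrank_prod_prod_self_eq (since := "2026-08-16")]
theorem finrank_prod3_target_eq :
    finrank ℝ (𝔼 q × (𝔼 q × 𝔼 q)) = finrank ℝ (𝔼 (q + (q + q))) :=
  finrank_prod_prod_self_eq

/-- **No quadruple points, generically, when `4n < 3q`.** Let `f : M → ℝ^q`, `ρ : M → ℝᵏ` be
`C^∞` with `ρ` sending pairwise distinct `a, b, c, d` to points with independent consecutive
differences, and `T : ℝᵇ →L (ℝᵏ →L ℝ^q)` with `s ↦ (T s u, T s v, T s w)` onto for independent
`u, v, w`. If `n + n + n + n < q + q + q` then the set of parameters `s` for which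
`f_s = f + (T s) ∘ ρ` has a quadruple point (pairwise distinct `a, b, c, d` with
`f_s a = f_s b = f_s c = f_s d`) is Lebesgue-null. [cite: HirschDT1976, Ch. 3 §2, Thm. 2.7 and Ex. 2] -/
theorem volume_setOf_exists_quadruplePoint_eq_zero (hdim : n + (n + (n + n)) < q + (q + q))
    (hf : ContMDiff (𝓡 n) (𝓡 q) ∞ f) (hρ : ContMDiff (𝓡 n) (𝓡 k) ∞ ρ)
    (hρ4 : ∀ a b c d : M, a ≠ b → a ≠ c → a ≠ d → b ≠ c → b ≠ d → c ≠ d →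
      LinearIndependent ℝ ![ρ a - ρ b, ρ b - ρ c, ρ c - ρ d])
    (hT : ∀ u v w : 𝔼 k, LinearIndependent ℝ ![u, v, w] →
      Surjective fun s : 𝔼 b => (T s u, T s v, T s w)) :
    volume {s : 𝔼 b | ∃ a b c d : M, a ≠ b ∧ a ≠ c ∧ a ≠ d ∧ b ≠ c ∧ b ≠ d ∧ c ≠ d ∧
      f a + T s (ρ a) = f b + T s (ρ b) ∧ f b + T s (ρ b) = f c + T s (ρ c) ∧
      f c + T s (ρ c) = f d + T s (ρ d)} = 0 := by
  -- re-charting and target splitting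
  let L : (𝔼 n × (𝔼 n × (𝔼 n × 𝔼 n))) ≃L[ℝ] 𝔼 (n + (n + (n + n))) :=
    ContinuousLinearEquiv.ofFinrankEq finrank_prod4_self_eq
  let Lq : (𝔼 q × (𝔼 q × 𝔼 q)) ≃L[ℝ] 𝔼 (q + (q + q)) :=
    ContinuousLinearEquiv.ofFinrankEq finrank_prod_prod_self_eq
  let L₁ : 𝔼 q →L[ℝ] 𝔼 (q + (q + q)) :=
    (Lq : (𝔼 q × (𝔼 q × 𝔼 q)) →L[ℝ] 𝔼 (q + (q + q))).comp (ContinuousLinearMap.inl ℝ (𝔼 q) (𝔼 q × 𝔼 q))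
  let L₂ : 𝔼 q →L[ℝ] 𝔼 (q + (q + q)) :=
    (Lq : (𝔼 q × (𝔼 q × 𝔼 q)) →L[ℝ] 𝔼 (q + (q + q))).comp
      ((ContinuousLinearMap.inr ℝ (𝔼 q) (𝔼 q × 𝔼 q)).comp (ContinuousLinearMap.inl ℝ (𝔼 q) (𝔼 q)))
  let L₃ : 𝔼 q →L[ℝ] 𝔼 (q + (q + q)) :=
    (Lq : (𝔼 q × (𝔼 q × 𝔼 q)) →L[ℝ] 𝔼 (q + (q + q))).comp
      ((ContinuousLinearMap.inr ℝ (𝔼 q) (𝔼 q × 𝔼 q)).comp (ContinuousLinearMap.inr ℝ (𝔼 q) (𝔼 q)))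
  have hL123 : ∀ a c e : 𝔼 q, L₁ a + L₂ c + L₃ e = Lq (a, c, e) := fun a c e => by
    show Lq (a, 0) + Lq (0, (c, 0)) + Lq (0, (0, e)) = Lq (a, c, e)
    rw [← map_add, ← map_add]
    congr 1
    simp
  let I₄ := (𝓡 n).prod ((𝓡 n).prod ((𝓡 n).prod (𝓡 n)))
  let V : Type u := Remodel I₄ L (M × M × M × M)
  let oR : V → M × M × M × M := Remodel.ofRemodel
  have hoR : ContMDiff (𝓡 (n + (n + (n + n)))) I₄ ∞ oR := Remodel.contMDiff_ofRemodel _ _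
  let fs : 𝔼 b → M → 𝔼 q := fun s t => f t + T s (ρ t)
  let Gf : (M × M × M × M) × 𝔼 b → 𝔼 (q + (q + q)) := fun ps =>
    L₁ (fs ps.2 ps.1.1 - fs ps.2 ps.1.2.1) + L₂ (fs ps.2 ps.1.2.1 - fs ps.2 ps.1.2.2.1) +
      L₃ (fs ps.2 ps.1.2.2.1 - fs ps.2 ps.1.2.2.2)
  let G : V × 𝔼 b → 𝔼 (q + (q + q)) := fun vs => Gf (oR vs.1, vs.2)
  -- smoothness
  have hev : ContDiff ℝ ∞ fun p : (𝔼 k →L[ℝ] 𝔼 q) × 𝔼 k => p.1 p.2 :=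
    isBoundedBilinearMap_apply.contDiff
  have hfsm : ∀ (π₀ : (M × M × M × M) × 𝔼 b → M), ContMDiff (I₄.prod (𝓡 b)) (𝓡 n) ∞ π₀ →
      ContMDiff (I₄.prod (𝓡 b)) (𝓡 q) ∞ fun ps => fs ps.2 (π₀ ps) := by
    intro π₀ hπ₀
    have hT2 : ContMDiff (I₄.prod (𝓡 b)) 𝓘(ℝ, 𝔼 k →L[ℝ] 𝔼 q) ∞
        fun ps : (M × M × M × M) × 𝔼 b => T ps.2 := T.contDiff.comp_contMDiff contMDiff_snd
    exact (hf.comp hπ₀).add (hev.comp_contMDiff (hT2.prodMk_space (hρ.comp hπ₀)))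
  have hp1 : ContMDiff (I₄.prod (𝓡 b)) (𝓡 n) ∞ fun ps : (M × M × M × M) × 𝔼 b => ps.1.1 :=
    contMDiff_fst.comp contMDiff_fst
  have hp2 : ContMDiff (I₄.prod (𝓡 b)) (𝓡 n) ∞ fun ps : (M × M × M × M) × 𝔼 b => ps.1.2.1 :=
    contMDiff_fst.comp (contMDiff_snd.comp contMDiff_fst)
  have hp3 : ContMDiff (I₄.prod (𝓡 b)) (𝓡 n) ∞ fun ps : (M × M × M × M) × 𝔼 b => ps.1.2.2.1 :=
    contMDiff_fst.comp (contMDiff_snd.comp (contMDiff_snd.comp contMDiff_fst))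
  have hp4 : ContMDiff (I₄.prod (𝓡 b)) (𝓡 n) ∞ fun ps : (M × M × M × M) × 𝔼 b => ps.1.2.2.2 :=
    contMDiff_snd.comp (contMDiff_snd.comp (contMDiff_snd.comp contMDiff_fst))
  have hGf : ContMDiff (I₄.prod (𝓡 b)) (𝓡 (q + (q + q))) ∞ Gf :=
    ((L₁.contDiff.comp_contMDiff ((hfsm _ hp1).sub (hfsm _ hp2))).add
      (L₂.contDiff.comp_contMDiff ((hfsm _ hp2).sub (hfsm _ hp3)))).add
      (L₃.contDiff.comp_contMDiff ((hfsm _ hp3).sub (hfsm _ hp4)))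
  have hG : ContMDiff ((𝓡 (n + (n + (n + n)))).prod (𝓡 b)) (𝓡 (q + (q + q))) ∞ G :=
    hGf.comp (hoR.prodMap contMDiff_id)
  have hGd : ∀ vs, MDifferentiableAt ((𝓡 (n + (n + (n + n)))).prod (𝓡 b)) (𝓡 (q + (q + q))) G vs :=
    fun vs => (hG vs).mdifferentiableAt (by simp)
  -- the open set off the fat diagonal
  have hc : Continuous fun vs : V × 𝔼 b => oR vs.1 :=
    (Remodel.continuous_ofRemodel _ _ _).comp continuous_fst
  have c1 : Continuous fun vs : V × 𝔼 b => (oR vs.1).1 := continuous_fst.comp hc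
  have c2 : Continuous fun vs : V × 𝔼 b => (oR vs.1).2.1 := continuous_fst.comp (continuous_snd.comp hc)
  have c3 : Continuous fun vs : V × 𝔼 b => (oR vs.1).2.2.1 :=
    continuous_fst.comp (continuous_snd.comp (continuous_snd.comp hc))
  have c4 : Continuous fun vs : V × 𝔼 b => (oR vs.1).2.2.2 :=
    continuous_snd.comp (continuous_snd.comp (continuous_snd.comp hc))
  have oo : ∀ {g h : V × 𝔼 b → M}, Continuous g → Continuous h →
      IsOpen {vs : V × 𝔼 b | g vs ≠ h vs} := fun hg hh =>
    (isClosed_diagonal.preimage (hg.prodMk hh)).isOpen_compl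
  let W : Set (V × 𝔼 b) :=
    {vs | (oR vs.1).1 ≠ (oR vs.1).2.1} ∩ ({vs | (oR vs.1).1 ≠ (oR vs.1).2.2.1} ∩
    ({vs | (oR vs.1).1 ≠ (oR vs.1).2.2.2} ∩ ({vs | (oR vs.1).2.1 ≠ (oR vs.1).2.2.1} ∩
    ({vs | (oR vs.1).2.1 ≠ (oR vs.1).2.2.2} ∩ {vs | (oR vs.1).2.2.1 ≠ (oR vs.1).2.2.2}))))
  have hW : IsOpen W :=
    (oo c1 c2).inter ((oo c1 c3).inter ((oo c1 c4).inter ((oo c2 c3).inter ((oo c2 c4).inter (oo c3 c4)))))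
  -- submersivity in `s`
  have hslice : ∀ (vs : V × 𝔼 b) (σ : 𝔼 b),
      mfderiv ((𝓡 (n + (n + (n + n)))).prod (𝓡 b)) (𝓡 (q + (q + q))) G vs (0, σ) =
        Lq (T σ (ρ (oR vs.1).1 - ρ (oR vs.1).2.1), T σ (ρ (oR vs.1).2.1 - ρ (oR vs.1).2.2.1),
          T σ (ρ (oR vs.1).2.2.1 - ρ (oR vs.1).2.2.2)) := by
    intro vs σ
    rw [← mfderiv_slice_right_apply (hGd vs)]
    -- name the points
    obtain ⟨x₁, x₂, x₃, x₄, hx⟩ : ∃ x₁ x₂ x₃ x₄ : M, oR vs.1 = (x₁, x₂, x₃, x₄) :=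
      ⟨_, _, _, _, rfl⟩
    let Ls : 𝔼 b →L[ℝ] 𝔼 (q + (q + q)) :=
      L₁.comp ((ContinuousLinearMap.apply ℝ (𝔼 q) (ρ x₁ - ρ x₂)).comp T) +
        L₂.comp ((ContinuousLinearMap.apply ℝ (𝔼 q) (ρ x₂ - ρ x₃)).comp T) +
        L₃.comp ((ContinuousLinearMap.apply ℝ (𝔼 q) (ρ x₃ - ρ x₄)).comp T)
    have hfun : (fun s => G (vs.1, s)) = fun s =>
        (L₁ (f x₁ - f x₂) + L₂ (f x₂ - f x₃) + L₃ (f x₃ - f x₄)) + Ls s := by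
      funext s
      show Gf (oR vs.1, s) = _
      rw [hx]
      show L₁ ((f x₁ + T s (ρ x₁)) - (f x₂ + T s (ρ x₂))) + L₂ ((f x₂ + T s (ρ x₂)) - (f x₃ + T s (ρ x₃))) +
          L₃ ((f x₃ + T s (ρ x₃)) - (f x₄ + T s (ρ x₄))) =
        (L₁ (f x₁ - f x₂) + L₂ (f x₂ - f x₃) + L₃ (f x₃ - f x₄)) +
          (L₁ (T s (ρ x₁ - ρ x₂)) + L₂ (T s (ρ x₂ - ρ x₃)) + L₃ (T s (ρ x₃ - ρ x₄)))
      have e : ∀ a a' c c' : 𝔼 q, (a + c) - (a' + c') = (a - a') + (c - c') := fun _ _ _ _ => by abel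
      rw [map_sub (T s), map_sub (T s), map_sub (T s), e, e, e, map_add, map_add, map_add]
      abel
    rw [hfun, mfderiv_eq_fderiv, fderiv_const_add, ContinuousLinearMap.fderiv, hx]
    show L₁ (T σ (ρ x₁ - ρ x₂)) + L₂ (T σ (ρ x₂ - ρ x₃)) + L₃ (T σ (ρ x₃ - ρ x₄)) = _
    exact hL123 _ _ _
  have hsurj : ∀ vs ∈ W, Surjective
      (mfderiv ((𝓡 (n + (n + (n + n)))).prod (𝓡 b)) (𝓡 (q + (q + q))) G vs) := by
    rintro vs ⟨h12, h13, h14, h23, h24, h34⟩ w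
    obtain ⟨σ, hσ⟩ := hT _ _ _ (hρ4 _ _ _ _ h12 h13 h14 h23 h24 h34) (Lq.symm w)
    refine ⟨(0, σ), ?_⟩
    rw [hslice]
    have hσ' : (T σ (ρ (oR vs.1).1 - ρ (oR vs.1).2.1), T σ (ρ (oR vs.1).2.1 - ρ (oR vs.1).2.2.1),
        T σ (ρ (oR vs.1).2.2.1 - ρ (oR vs.1).2.2.2)) = Lq.symm w := hσ
    rw [hσ', ContinuousLinearEquiv.apply_symm_apply]
  -- parametric transversality, and the dimension count at a zero
  have hPT := volume_setOf_not_surjective_mfderiv_slice_eq_zero hW hG.contMDiffOn hsurj 0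
  refine measure_mono_null ?_ hPT
  rintro s ⟨a, b', c, d, hab, hac, had, hbc, hbd, hcd, hd1, hd2, hd3⟩
  refine ⟨Remodel.toRemodel I₄ L (M × M × M × M) (a, b', c, d), ⟨hab, hac, had, hbc, hbd, hcd⟩,
    ?_, fun hS => ?_⟩
  · show L₁ ((f a + T s (ρ a)) - (f b' + T s (ρ b'))) + L₂ ((f b' + T s (ρ b')) - (f c + T s (ρ c))) +
        L₃ ((f c + T s (ρ c)) - (f d + T s (ρ d))) = 0
    rw [hd1, hd2, hd3, sub_self, map_zero, map_zero, map_zero, add_zero, add_zero]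
  · -- an onto linear map `ℝ^{4n} → ℝ^{3q}` would need `3q ≤ 4n`
    obtain ⟨A, hA⟩ : ∃ A : 𝔼 (n + (n + (n + n))) →ₗ[ℝ] 𝔼 (q + (q + q)), Surjective A :=
      ⟨(mfderiv (𝓡 (n + (n + (n + n)))) (𝓡 (q + (q + q))) (fun v' => G (v', s))
        (Remodel.toRemodel I₄ L (M × M × M × M) (a, b', c, d))).toLinearMap, hS⟩
    have h1 := A.finrank_range_le
    rw [LinearMap.range_eq_top.2 hA, finrank_top, finrank_euclideanSpace_fin,
      finrank_euclideanSpace_fin] at h1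
    omega

/-- **No quadruple points, generically** (density form). [cite: HirschDT1976, Ch. 3 §2, Thm. 2.7 and Ex. 2] -/
theorem dense_setOf_forall_not_quadruplePoint (hdim : n + (n + (n + n)) < q + (q + q))
    (hf : ContMDiff (𝓡 n) (𝓡 q) ∞ f) (hρ : ContMDiff (𝓡 n) (𝓡 k) ∞ ρ)
    (hρ4 : ∀ a b c d : M, a ≠ b → a ≠ c → a ≠ d → b ≠ c → b ≠ d → c ≠ d →
      LinearIndependent ℝ ![ρ a - ρ b, ρ b - ρ c, ρ c - ρ d])
    (hT : ∀ u v w : 𝔼 k, LinearIndependent ℝ ![u, v, w] →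
      Surjective fun s : 𝔼 b => (T s u, T s v, T s w)) :
    Dense {s : 𝔼 b | ∀ a b c d : M, a ≠ b → a ≠ c → a ≠ d → b ≠ c → b ≠ d → c ≠ d →
      f a + T s (ρ a) = f b + T s (ρ b) → f b + T s (ρ b) = f c + T s (ρ c) →
      f c + T s (ρ c) ≠ f d + T s (ρ d)} := by
  have h := dense_compl_of_volume_eq_zero
    (volume_setOf_exists_quadruplePoint_eq_zero hdim hf hρ hρ4 hT)
  refine h.mono fun s hs a b' c d hab hac had hbc hbd hcd hd1 hd2 hd3 => ?_
  exact hs ⟨a, b', c, d, hab, hac, had, hbc, hbd, hcd, hd1, hd2, hd3⟩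

end Family

end Literature.Topology.Immersions
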